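import Literature.Probability.RandomPlanarGeometry.BDGS2012GrahamShortPieces
import HarnessLib

/-!
# Graham's Borel-type bound for `z_c(d)` (BDGS 2012, (1.20)), VII: the bound on the lace graphs
# of length `≥ 2M`, type `≤ M` and pieces `≤ K₀` (Graham 2010, §6, the term `A₃`)

Sibling file of `Literature.Probability.RandomPlanarGeometry.BDGS2012` (fact
`BDGS2012_Graham_criticalPoint_bound` = Graham 2010, Theorem 1), sequel to
`BDGS2012GrahamShortPieces.lean` (the abstract generating-function estimate) and
`BDGS2012GrahamPieces.lean` (`z^a · diagTotalLe d a M K ≤ cpow f (M+1) a`), instantiated with the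
maximum-principle piece weights of `BDGS2012GrahamSRWMax.lean`.

## What the source prints (Graham 2010, §5 and §6)

Lemma 7: "`π̂_a^{(N)}(0;τ) ≤ [β^a](Σ_{n=1}^{τ/2} C₄ⁿ s⁻ⁿ n! β^{2n}(1+s/β))^N`", resting on "When `k` is
even, `c_k^{(0)}(x)` is maximized by `x = 0` … `(2m) c_{2m}^{(0)}(0) ≤ C₄^m s^{-m} m!` … When `k` is
odd, `c_k^{(0)}(x)` is maximized by `x = e₁` and `c_{2m-1}^{(0)}(e₁) = c_{2m}^{(0)}(0)/(2d)`"; §6: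
"`|A₃| ≤ Σ_{N=1}^{M} Σ_{a=2M}^{2MN} β_τ^a [β^a](⋯)^N ≤ … ≤ ¼ s^M C₆^{M+1}(M+1)!`".

## What is formalised (namespace `Literature.Probability.RandomPlanarGeometry.SAW.Zd.Graham2010`)

* `qMax d k` — the maximum-principle bound `sup_x c_k^{(0)}(x)`: `c_k(0)` for even `k`, `c_k(e₀)`
  for odd `k`; `count_le_qMax`; the factorial bounds `qMax_two_mul_le`, `qMax_two_mul_sub_one_le`;
* `pieceWt d z K₀ k = (k+1) · qMax d k · z^k` on `[1, K₀]` (`0` otherwise) and its bound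
  **`pieceWt_le`**: `pieceWt ≤ Γ₀ · 144^m m! s^m`, `m = ⌈k/2⌉`, `s = 1/(2d)`, whenever
  `(2dz)^k ≤ Γ₀` (this is Lemma 7's `C₄ⁿ s⁻ⁿ n! β^{2n}(1+s/β)` after `β ≤ (2dz)·s`);
* **`sum_diagTotalLe_short_le`** — the term `A₃` at infinite memory with piece cap `K₀`:
  `Σ_{N=1}^{M} Σ_{a=2M}^{hi} z^a · diagTotalLe d a (N-1) K₀ ≤ (6912 Γ₀)^{M+1} (M+1)! s^M` whenever
  `1152 Γ₀ M s ≤ 1` and `144 (K₀ + 2) s ≤ 1`.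

Not here: the lace graphs with a piece longer than `K₀` (the next files).
-/

noncomputable section

open Finset
open Literature.Probability.LatticeModels Literature.Probability.LatticeModels.SRW
open Literature.Barriers.CriticalPhenomena.SAWLace
open scoped BigOperators

namespace Literature.Probability.RandomPlanarGeometry.SAW.Zd.Graham2010

variable {d : ℕ}

/-! ### The maximum-principle piece weights -/

/-- `qMax d k = sup_x c_k^{(0)}(x)` realised by the maximum principles: `c_k(0)` for even `k`,
`c_k(e₀)` for odd `k` (any unit vector; `d ≥ 1`). [cite: Graham2010, Section 5, proof of Lemma 7] -/
def qMax (d : ℕ) [NeZero d] (k : ℕ) : ℕ :=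
  if Even k then SRW.count d k 0 else SRW.count d k (Pi.single (⟨0, Nat.pos_of_neZero d⟩ : Fin d) 1)

/-- **`c_k^{(0)}(x) ≤ qMax d k`** for all `x` (even `k`: `SRW.count_add_self_le`; odd `k`: the odd
maximum principle `count_le_count_single`). [cite: Graham2010, Section 5, proof of Lemma 7] -/
theorem count_le_qMax [NeZero d] (k : ℕ) (x : Site d) : SRW.count d k x ≤ qMax d k := by
  unfold qMax
  split_ifs with h
  · obtain ⟨m, rfl⟩ := h
    exact count_add_self_le m x
  · exact count_le_count_single (Nat.not_even_iff_odd.1 h) _ x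

/-- Even lengths: `qMax d (2m) = c_{2m}(0) ≤ (m+1) 36^m m! d^m` (`1 ≤ m ≤ d`).
[cite: Graham2010, Section 5, proof of Lemma 7] -/
theorem qMax_two_mul_le [NeZero d] {m : ℕ} (hm : 1 ≤ m) (hmd : m ≤ d) :
    (qMax d (2 * m) : ℝ) ≤ ((m : ℝ) + 1) * (36 : ℝ) ^ m * (m.factorial : ℝ) * (d : ℝ) ^ m := by
  unfold qMax
  rw [if_pos ⟨m, two_mul m⟩]
  exact count_two_mul_zero_le hm hmd

/-- Odd lengths: `2d · qMax d (2m-1) = c_{2m}(0)`, so `qMax d (2m-1) ≤ (m+1) 36^m m! d^m / (2d)`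
(`1 ≤ m ≤ d`). [cite: Graham2010, Section 5, proof of Lemma 7] -/
theorem qMax_two_mul_sub_one_le [NeZero d] {m : ℕ} (hm : 1 ≤ m) (hmd : m ≤ d) :
    (qMax d (2 * m - 1) : ℝ) ≤ ((m : ℝ) + 1) * (36 : ℝ) ^ m * (m.factorial : ℝ) * (d : ℝ) ^ m / (2 * (d : ℝ)) := by
  have hd : (0 : ℝ) < d := by exact_mod_cast lt_of_lt_of_le hm hmd
  unfold qMax
  rw [if_neg (by rw [Nat.not_even_iff_odd]; exact ⟨m - 1, by omega⟩)]
  rw [le_div_iff₀ (by positivity)]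
  have h := two_mul_card_mul_count_single (2 * m - 1) (⟨0, Nat.pos_of_neZero d⟩ : Fin d)
  rw [show 2 * m - 1 + 1 = 2 * m by omega] at h
  have h' : (SRW.count d (2 * m - 1) (Pi.single (⟨0, Nat.pos_of_neZero d⟩ : Fin d) 1) : ℝ) * (2 * (d : ℝ)) =
      (SRW.count d (2 * m) 0 : ℝ) := by exact_mod_cast (by rw [← h]; ring)
  rw [h']
  exact count_two_mul_zero_le hm hmd

/-- The piece generating function of Lemma 7 with the cap `K₀`:
`pieceWt d z K₀ k = (k+1) · qMax d k · z^k` for `1 ≤ k ≤ K₀`, `0` otherwise.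
[cite: Graham2010, Lemma 7] -/
def pieceWt (d : ℕ) [NeZero d] (z : ℝ) (K₀ k : ℕ) : ℝ :=
  if k = 0 ∨ K₀ < k then 0 else ((k : ℝ) + 1) * (qMax d k : ℝ) * z ^ k

/-- `(2m+1)(m+1) ≤ 8^m` and `2m(m+1) ≤ 8^m` for `m ≥ 1`. [folklore] -/
theorem poly_le_eight_pow {m : ℕ} (hm : 1 ≤ m) : (2 * (m : ℝ) + 1) * ((m : ℝ) + 1) ≤ (8 : ℝ) ^ m := by
  have key : ∀ n : ℕ, (2 * ((n + 1 : ℕ) : ℝ) + 1) * (((n + 1 : ℕ) : ℝ) + 1) ≤ (8 : ℝ) ^ (n + 1) := by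
    intro n
    induction n with
    | zero => norm_num
    | succ n ih =>
      rw [pow_succ]
      have hn : (0 : ℝ) ≤ n := Nat.cast_nonneg n
      push_cast at ih ⊢
      nlinarith [ih]
  obtain ⟨n, rfl⟩ : ∃ n, m = n + 1 := ⟨m - 1, by omega⟩
  exact key n

/-- **The factorial bound on the piece weights** (Lemma 7's `C₄ⁿ s⁻ⁿ n! β^{2n}(1+s/β)`): if
`(2dz)^k ≤ Γ₀` then `pieceWt d z K₀ k ≤ Γ₀ · 144^m · m! · s^m` with `m = (k+1)/2 = ⌈k/2⌉` and
`s = 1/(2d)`, for `1 ≤ k ≤ K₀` with `(K₀+1)/2 ≤ d`. [cite: Graham2010, Lemma 7] -/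
theorem pieceWt_le [NeZero d] {z Γ₀ : ℝ} (hz : 0 ≤ z) {K₀ k : ℕ} (hk1 : 1 ≤ k) (hkK : k ≤ K₀)
    (hKd : (K₀ + 1) / 2 ≤ d) (hθ : (2 * (d : ℝ) * z) ^ k ≤ Γ₀) :
    pieceWt d z K₀ k ≤ Γ₀ * (144 : ℝ) ^ ((k + 1) / 2) * (((k + 1) / 2).factorial : ℝ) *
      (1 / (2 * (d : ℝ))) ^ ((k + 1) / 2) := by
  set m := (k + 1) / 2 with hm
  have hm1 : 1 ≤ m := by omega
  have hmd : m ≤ d := le_trans (Nat.div_le_div_right (by omega)) hKd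
  have hd : (0 : ℝ) < d := by exact_mod_cast lt_of_lt_of_le hm1 hmd
  have hΓ₀ : 0 ≤ Γ₀ := le_trans (by positivity) hθ
  unfold pieceWt
  rw [if_neg (by omega)]
  -- `z^k = (2dz)^k (2d)^{-k}`
  have hzk : z ^ k = (2 * (d : ℝ) * z) ^ k * (1 / (2 * (d : ℝ))) ^ k := by
    rw [← mul_pow]; congr 1; field_simp
  have hpoly := poly_le_eight_pow hm1
  -- the power identity `36^m d^m (1/(2d))^{2m} = 18^m (1/(2d))^m`
  have e2 : (36 : ℝ) ^ m * (d : ℝ) ^ m * (1 / (2 * (d : ℝ))) ^ (2 * m) = (18 : ℝ) ^ m * (1 / (2 * (d : ℝ))) ^ m := by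
    rw [pow_mul, ← mul_pow, ← mul_pow, ← mul_pow]
    congr 1
    field_simp
    ring
  rcases Nat.even_or_odd k with ⟨j, hj⟩ | ⟨j, hj⟩
  · -- `k = 2m`
    have hkm : k = 2 * m := by omega
    have hq := qMax_two_mul_le (d := d) hm1 hmd
    rw [← hkm] at hq
    have hk' : (k : ℝ) + 1 = 2 * m + 1 := by
      have : k + 1 = 2 * m + 1 := by omega
      exact_mod_cast this
    calc ((k : ℝ) + 1) * (qMax d k : ℝ) * z ^ k
        ≤ ((k : ℝ) + 1) * (((m : ℝ) + 1) * (36 : ℝ) ^ m * (m.factorial : ℝ) * (d : ℝ) ^ m) *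
            (Γ₀ * (1 / (2 * (d : ℝ))) ^ k) := by
          rw [hzk]
          refine mul_le_mul (mul_le_mul_of_nonneg_left hq (by positivity))
            (mul_le_mul_of_nonneg_right hθ (by positivity)) (by positivity) (by positivity)
      _ = Γ₀ * ((2 * (m : ℝ) + 1) * ((m : ℝ) + 1)) * (m.factorial : ℝ) *
            ((36 : ℝ) ^ m * (d : ℝ) ^ m * (1 / (2 * (d : ℝ))) ^ (2 * m)) := by
          rw [hk', ← hkm]; ring
      _ = Γ₀ * ((2 * (m : ℝ) + 1) * ((m : ℝ) + 1)) * (18 : ℝ) ^ m * (m.factorial : ℝ) *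
            (1 / (2 * (d : ℝ))) ^ m := by
          rw [e2]; ring
      _ ≤ Γ₀ * (8 : ℝ) ^ m * (18 : ℝ) ^ m * (m.factorial : ℝ) * (1 / (2 * (d : ℝ))) ^ m := by gcongr
      _ = Γ₀ * (144 : ℝ) ^ m * (m.factorial : ℝ) * (1 / (2 * (d : ℝ))) ^ m := by
          rw [show (144 : ℝ) = 8 * 18 by norm_num, mul_pow]; ring
  · -- `k = 2m - 1`
    have hkm : k = 2 * m - 1 := by omega
    have hq := qMax_two_mul_sub_one_le (d := d) hm1 hmd
    rw [← hkm] at hq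
    have hk' : (k : ℝ) + 1 = 2 * m := by
      have : k + 1 = 2 * m := by omega
      exact_mod_cast this
    have hpow : (1 / (2 * (d : ℝ))) ^ k = (1 / (2 * (d : ℝ))) ^ (2 * m) * (2 * (d : ℝ)) := by
      have : 2 * m = k + 1 := by omega
      rw [this, pow_succ]; field_simp
    have h2d : (2 * (d : ℝ)) / (2 * (d : ℝ)) = 1 := div_self (by positivity)
    calc ((k : ℝ) + 1) * (qMax d k : ℝ) * z ^ k
        ≤ ((k : ℝ) + 1) * (((m : ℝ) + 1) * (36 : ℝ) ^ m * (m.factorial : ℝ) * (d : ℝ) ^ m / (2 * (d : ℝ))) *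
            (Γ₀ * (1 / (2 * (d : ℝ))) ^ k) := by
          rw [hzk]
          refine mul_le_mul (mul_le_mul_of_nonneg_left hq (by positivity))
            (mul_le_mul_of_nonneg_right hθ (by positivity)) (by positivity) (by positivity)
      _ = Γ₀ * (2 * (m : ℝ) * ((m : ℝ) + 1)) * (m.factorial : ℝ) *
            ((36 : ℝ) ^ m * (d : ℝ) ^ m * (1 / (2 * (d : ℝ))) ^ (2 * m)) * ((2 * (d : ℝ)) / (2 * (d : ℝ))) := by
          rw [hk', hpow]; ring
      _ = Γ₀ * (2 * (m : ℝ) * ((m : ℝ) + 1)) * (18 : ℝ) ^ m * (m.factorial : ℝ) *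
            (1 / (2 * (d : ℝ))) ^ m := by
          rw [e2, h2d]; ring
      _ ≤ Γ₀ * (8 : ℝ) ^ m * (18 : ℝ) ^ m * (m.factorial : ℝ) * (1 / (2 * (d : ℝ))) ^ m := by
          gcongr
          nlinarith [hpoly]
      _ = Γ₀ * (144 : ℝ) ^ m * (m.factorial : ℝ) * (1 / (2 * (d : ℝ))) ^ m := by
          rw [show (144 : ℝ) = 8 * 18 by norm_num, mul_pow]; ring

/-- **The term `A₃` at infinite memory** (lace graphs of type `N ≤ M`, length `a ≥ 2M`, all
pieces `≤ K₀`): with `s = 1/(2d)`, if `(2dz)^k ≤ Γ₀` for `k ≤ K₀`, `1152 Γ₀ M s ≤ 1` and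
`144 (K₀ + 2) s ≤ 1`, then
`Σ_{N=1}^{M} Σ_{a=2M}^{hi} z^a · diagTotalLe d a (N-1) K₀ ≤ (6912 Γ₀)^{M+1} (M+1)! s^M`
(Graham: "`|A₃| ≤ … ≤ ¼ s^M C₆^{M+1}(M+1)!`"). [cite: Graham2010, Section 6, estimate of `A₃`] -/
theorem sum_diagTotalLe_short_le [NeZero d] {z Γ₀ : ℝ} (hz : 0 ≤ z) (hΓ₀ : 1 ≤ Γ₀) {K₀ M : ℕ}
    (hM : 1 ≤ M) (hθ : ∀ k, k ≤ K₀ → (2 * (d : ℝ) * z) ^ k ≤ Γ₀)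
    (hsmall : 1152 * Γ₀ * M * (1 / (2 * (d : ℝ))) ≤ 1)
    (hratio : 144 * ((K₀ : ℝ) + 2) * (1 / (2 * (d : ℝ))) ≤ 1) (hi : ℕ) :
    ∑ N ∈ Finset.Icc 1 M, ∑ a ∈ Finset.Icc (2 * M) hi, (diagTotalLe d a (N - 1) K₀ : ℝ) * z ^ a ≤
      (6912 * Γ₀) ^ (M + 1) * ((M + 1).factorial : ℝ) * (1 / (2 * (d : ℝ))) ^ M := by
  have hdpos : 0 < d := Nat.pos_of_neZero d
  have hd : (0 : ℝ) < d := by exact_mod_cast hdpos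
  set s : ℝ := 1 / (2 * (d : ℝ)) with hs
  have hs0 : 0 < s := by rw [hs]; positivity
  -- `K₀ + 2 ≤ 2d/144`, hence `(K₀+1)/2 ≤ d`
  have hKd : (K₀ + 1) / 2 ≤ d := by
    have h1 : 144 * ((K₀ : ℝ) + 2) ≤ 2 * d := by
      rw [hs] at hratio
      rwa [← mul_div_assoc, mul_one, div_le_one (by positivity)] at hratio
    have h2 : (K₀ : ℝ) + 2 ≤ d := by nlinarith
    have h3 : K₀ + 2 ≤ d := by exact_mod_cast h2
    omega
  set f : ℕ → ℝ := pieceWt d z K₀ with hf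
  have hf0 : ∀ k, 0 ≤ f k := by
    intro k; simp only [hf, pieceWt]; split_ifs <;> positivity
  have hfz : ∀ k, (k = 0 ∨ K₀ < k) → f k = 0 := by
    intro k hk; simp only [hf, pieceWt]; rw [if_pos hk]
  have hfb : ∀ k, 1 ≤ k → k ≤ K₀ →
      f k ≤ Γ₀ * (144 : ℝ) ^ ((k + 1) / 2) * (((k + 1) / 2).factorial : ℝ) * s ^ ((k + 1) / 2) :=
    fun k hk1 hkK => pieceWt_le hz hk1 hkK hKd (hθ k hkK)
  have hsmall' : 8 * Γ₀ * 144 * M * s ≤ 1 := by rw [hs]; linarith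
  have hratio' : (144 : ℝ) * ((K₀ : ℝ) + 2) * s ≤ 1 := hratio
  have hmain := sum_shortPieces_bound hs0 hΓ₀ (by norm_num : (1 : ℝ) ≤ 144) hM hf0 hfz hfb hsmall' hratio' hi
  refine le_trans (Finset.sum_le_sum fun N hN => Finset.sum_le_sum fun a _ => ?_) (hmain.trans (le_of_eq ?_))
  · -- `z^a · diagTotalLe d a (N-1) K₀ ≤ cpow f N a`
    rw [Finset.mem_Icc] at hN
    have h := diagTotalLe_mul_pow_le_cpow (fun k x => count_le_qMax (d := d) k x) hz a (N - 1) K₀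
    rw [show N - 1 + 1 = N by omega] at h
    exact h
  · rw [show (48 : ℝ) * Γ₀ * 144 = 6912 * Γ₀ by ring]

end Literature.Probability.RandomPlanarGeometry.SAW.Zd.Graham2010
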